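import Summits.HodgeConjecture.HodgeConjecture.Theorems.F0LD2LocalTypesRankTwo
import Summits.HodgeConjecture.HodgeConjecture.Theorems.F0P5CurveThetaCompanionRelabelOfNonsplitIfLetter
import Summits.HodgeConjecture.HodgeConjecture.Theorems.F0P5LemD14IfNonsplitLetter
import Literature.NumberTheory.Automorphic.Liu2021.LocalNormClassFlip
import Literature.NumberTheory.Automorphic.ConjugateSelfDualLocalValues
import Literature.NumberTheory.Automorphic.QuadraticNonsplitPlaceOfNotIsSquare
import HarnessLib

/-!
# LD2 organ U₂′ pay-down, E₂ stage B — at a NON-SPLIT place `v`, equivalent rank-2 local types `Θ_v(λ, a, χ) ≃ Θ_v(λ, a′, χ)` at the SAME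
# label `λ` force the SAME LINE CLASS `locF a v = locF a′ v` ([Liu2021, Lem. D.1 (4) + (1)] AS PRINTED, consumed through the booked letters
# ★ `LemD1RankTwoCMLetters.LemD1_4AsPrintedNonsplitCM₂` and ★ `…LemD1_1AsPrintedCM₂` on the COMPANION family — no new letter)

Cell `hodgecm-mathlib`, half A line LD2 (socket 27458 `stub_S1b_facts`; organ U₂′ `TwoTriples₂`, same-λ half E₂ = hypothesis `hE` of ★
`F0LD2LineClassOfEquiv.lineClassRigidity₂_of_equivForces`) and line LD1 ((P♯) line pin); seat LD2-p01 (g0), 2026-09-02.  THEOREMS ONLY;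
`--supports stmt-HodgeConjecture-24832`.

THE MATHEMATICS ([Liu2021, App. D Lem. D.1 (4), p. 126]: «if `n = 2` and `ω(μ, ε, χ) ≠ 0`, then `ω(μ′, ε′, χ′) ≅ ω(μ, ε, χ)` iff `(μ′, ε′, χ′) = (μ, ε, χ)`,
or `μ′ = μᶜχ̌`, `χ′ = χ`, and `ε′ = ε` (resp. `ε′ ≠ ε`) when `V` is isotropic (resp. anisotropic)»; (1): «zero iff `E` field, `V` anisotropic, `χ̌ = μ²`»).
At a non-split `v`, fix the companion label `λ′ = λᶜ·χ̌` (hypothesis `hH`) and a line `b` with «`b ~ a` at `v` iff `V_v` isotropic» (hypothesis `hflipv`; globally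
such `b` is ★ R1 `F0P5PaydownStubRelabelUnit`).  The PROVED «if» half (★ `lemD1_4IfAsPrintedNonsplitCM₂_holds`, ★
`areIsomorphicRep_localFactor_companion_of_lemD1_4IfAsPrintedI`) gives `Θ_v(λ′, b, χ) ≅ Θ_v(λ, a, χ)`, hence `≅ Θ_v(λ, a′, χ)`; the FULL letter read on the
family `{(λ, a′, χ), (λ′, b, χ)}` (★ (r1) `lemD1_4_localFactors_of_lemD1_4AsPrintedI₂`) then says: EITHER `λ′_v = λ_v` and `a′ ~ b` — at an anisotropic `v`
this forces `χ̌_v = λ_v²` (`λ_v·λ_vᶜ = 1`, ★ `IsConjugateSymplectic.toHeckeCharacter_galConj_complexConj`; ★ `localMu_galConj_mul_checkOfChi_apply`), so by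
letter (1) `Θ_v(λ, a′, χ) = 0`, contradicting non-vanishing; at an isotropic `v`, `a′ ~ b ~ a` — OR `λ′_v = λ_vᶜχ̌_v` with `a′ ~ b` iff isotropic: at isotropic `v`
again `a′ ~ b ~ a`, at anisotropic `v` `a′ ≁ b ≁ a`, so `a′ ~ a` in the two-element class group (★ `ne_iff_flip_of_not_isSquare`).

HONEST LABEL.  HC_CM is proved only modulo the 7 printed citations (2 remaining: hLiu418 = stmt-HodgeConjecture-24832, h413 =
stmt-HodgeConjecture-24833) until rung 0 closes; this file discharges none of them; its letters `h4`, `h1` are the booked ★ p832219 rows.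

## References
* [Liu2021] Y. Liu, Camb. J. Math. 9 (2021) = arXiv:2102.11518: App. D §D.1 Steps 1–3 (l. 5213–5224), Lem. D.1 (1), (4) (p. 125–126) and proof
  (p. 126–127); Def. 4.1, Def. 4.11.
* [Omeara1963] O. T. O'Meara, *Introduction to Quadratic Forms*, §63B.
-/

set_option autoImplicit false
set_option linter.dupNamespace false

noncomputable section

open scoped Matrix Kronecker RestrictedProduct NumberField TensorProduct
open NumberField IsDedekindDomain Filter
open Literature.NumberTheory Literature.NumberTheory.Automorphic Literature.NumberTheory.Automorphic.UnitaryGroup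
open Literature.NumberTheory.GelbartRogawski1991 Literature.NumberTheory.GelbartRogawski1991.UnitaryDualPair
open Literature.NumberTheory.GelbartRogawski1991.UnitaryDualPair.WeilCoinv
open Literature.NumberTheory.GelbartRogawski1991.UnitaryDualPair.LocalSplitting
open Literature.NumberTheory.GelbartRogawski1991.GRConstruction
open Literature.NumberTheory.Weil1964 Literature.RepresentationTheory
open Literature.RepresentationTheory.HeisenbergGroup
open Literature.NumberTheory.GaloisRepresentations Literature.RepresentationTheory.HarrisKudlaSweet1996
open Literature.NumberTheory.Automorphic.IdeleClassGroup Literature.RepresentationTheory.Liu2021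
open Literature.NumberTheory.Automorphic.Liu2021 Literature.NumberTheory.Automorphic.Liu2021.Def411WeilCarriers
open Literature.NumberTheory.Automorphic.Liu2021.Def411WeilCarriersDoubling
open Literature.NumberTheory.Automorphic.Liu2021.LemD1RankTwoCMLetters
open Literature.NumberTheory.Automorphic.Liu2021.RemD5
open Summit.HodgeConjecture.HodgeConjecture.Cruxes.HLiu418.F0P5CurveThetaCompanionRelabelOfLocalFactors
open Summit.HodgeConjecture.HodgeConjecture.Cruxes.HLiu418.F0P5CurveThetaCompanionRelabelOfNonsplitIfLetter
open Summit.HodgeConjecture.HodgeConjecture.Cruxes.HLiu418.F0P5LemD14IfNonsplitLetter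
open Summit.HodgeConjecture.HodgeConjecture.Cruxes.HLiu418.F0LD2LocalTypesRankTwo

namespace Summit.HodgeConjecture.HodgeConjecture.Cruxes.HLiu418.F0LD2SameLabelLineClassAtPlace

variable (L : Type) [Field L] [NumberField L] [IsCMField L]

/-! ## §1 `λ_v(x) · λ_v(xᶜ) = 1` for a conjugate-symplectic `λ` ([Liu2021, Def. 4.1] `μ(y ȳ) = 1`) -/

/-- **`λ_v(x)·λ_v(xᶜ) = 1`** on `E_vˣ = ∏_{w ∣ v} L_wˣ` for a conjugate-symplectic idèle class character `λ` (`λᶜ = λ⁻¹` as Hecke characters, ★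
`IsConjugateSymplectic.toHeckeCharacter_galConj_complexConj`; `(Λᶜ)_v(x) = Λ_v((𝔠 ⊗ 1)x)`, ★ `localMu_galConj_apply`). [cite: Liu2021, Def. 4.1 (l. 1900–1902); App. D §D.1 Step 2 (l. 5219)] -/
theorem localMu_mul_localMu_conj_eq_one (lam : Literature.NumberTheory.Automorphic.IdeleClassGroup L →ₜ* Circle)
    (hlam : IsConjugateSymplectic L lam) (v : HeightOneSpectrum (𝓞 (Fp L))) (x : (LocalRing L v)ˣ) :
    localMu L (toHeckeCharacter L lam) v x *
      localMu L (toHeckeCharacter L lam) v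
        (Units.map (conjLocal L (IsCMField.complexConj L) v : LocalRing L v →* LocalRing L v) x) = 1 := by
  rw [← CheckOfChi.localMu_galConj_apply, ← toHeckeCharacter_galConj, hlam.toHeckeCharacter_galConj_complexConj, localMu_apply, localMu_apply,
    ← Finset.prod_mul_distrib]
  exact Finset.prod_eq_one fun w _ => by rw [HeckeCharacter.inv_apply, mul_inv_cancel]

/-! ## §2 At a NON-SPLIT place: equivalent local types at the same label have the same line class -/

section Place

variable {n' : ℕ} (e₁ : Fin 2 × Fin 1 ≃ Fin n') (dV : Fin 2 → L) (hdV : ∀ i, IsCMField.complexConj L (dV i) = dV i) (hdV0 : ∀ i, dV i ≠ 0)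
  (lam : Literature.NumberTheory.Automorphic.IdeleClassGroup L →ₜ* Circle) (hlam : IsConjugateSymplectic L lam)
  (a a' : (Fp L)ˣ) (χ : Chi (Fp L) L (IsCMField.complexConj L))
  (lam' : Literature.NumberTheory.Automorphic.IdeleClassGroup L →ₜ* Circle)
  (v : HeightOneSpectrum (𝓞 (Fp L)))

set_option maxHeartbeats 3200000 in -- the CM θ-package family terms (two members + the letters' family), cf. ★ R2′ assembler (800 k per member)
/-- **E₂ AT A NON-SPLIT PLACE.**  Registered frame tokens; `λ′` the companion label (`toHeckeCharacter λ′ = (toHeckeCharacter λ)ᶜ · χ̌`); `b` a line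
with «`locF b v = locF a v` iff `(L_v², diag dV)` isotropic»; `v` non-split; the booked letters `h4` = [Liu2021, Lem. D.1 (4)] (companion family,
non-split) and `h1` = [Liu2021, Lem. D.1 (1)]; both carriers `ω(λ, ε_a, χ)_f`, `ω(λ, ε_{a′}, χ)_f` NON-ZERO.  THEN an equivalence of local types
`Θ_v(λ, a, χ) ≃ Θ_v(λ, a′, χ)` (output of ★ `nonempty_equiv_localTypes₂`) forces `locF a v = locF a′ v`.
[cite: Liu2021, App. D Lem. D.1 (1), (4) (p. 125–126); §D.1 Steps 1–3; Def. 4.1] [cite: Omeara1963, §63B] -/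
theorem locF_apply_eq_of_equiv_localTypes_nonsplit
    (hcc : IsCMField.complexConj L * IsCMField.complexConj L = 1) (hlam' : IsConjugateSymplectic L lam')
    (hH : toHeckeCharacter L lam' =
      toHeckeCharacter L (IdeleClassGroup.galConj (IsCMField.complexConj L) lam) * HeckeCharacter.checkOfChi hcc χ)
    (hJh : ((Matrix.diagonal dV).map (IsCMField.complexConj L))ᵀ = Matrix.diagonal dV) (hJdet : (Matrix.diagonal dV).det ≠ 0)
    (b : (Fp L)ˣ)
    (hflipv : locF (Fp L) (imagUnitSq L) b v = locF (Fp L) (imagUnitSq L) a v ↔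
      LemD1.IsIsotropic (LemD1OfPlace.standingData L v (IsCMField.complexConj L) 2 (Matrix.diagonal dV)
        (complexConj_imagUnit L) (imagUnit_ne_zero L) le_rfl hJh hJdet))
    (hns : ∀ w : UnitaryGroup.PlacesOver L v, IsCMField.complexConj L • (w : HeightOneSpectrum (𝓞 L)) = w)
    (h4 : LemD1_4AsPrintedNonsplitCM₂) (h1 : LemD1_1AsPrintedCM₂)
    [Nontrivial (omegaAtLine (Fp L) L (IsCMField.complexConj L) 2 e₁ (Matrix.diagonal dV) (complexConj_imagUnit L) (imagUnit_ne_zero L) (imagUnit_mul_self L) (realDiagonal_isSymm L dV hdV) (isUnit_det_realDiagonal L dV hdV hdV0) (realDiagonal_map L dV hdV).symm (fun b => isCompatible_chiSplittingLine L e₁ dV hdV hdV0 (toHeckeCharacter L lam) (isUnitary_toHeckeCharacter L lam) ((isOscillatorChar_toHeckeCharacter_iff lam).mpr hlam) (TW (Fp L) b) (isSymm_TW (Fp L) b) (isUnit_det_TW (Fp L) b) (JW (Fp L) L b) (JW_eq (Fp L) L b)) a χ)] [Nontrivial (omegaAtLine (Fp L) L (IsCMField.complexConj L) 2 e₁ (Matrix.diagonal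 dV) (complexConj_imagUnit L) (imagUnit_ne_zero L) (imagUnit_mul_self L) (realDiagonal_isSymm L dV hdV) (isUnit_det_realDiagonal L dV hdV hdV0) (realDiagonal_map L dV hdV).symm (fun b => isCompatible_chiSplittingLine L e₁ dV hdV hdV0 (toHeckeCharacter L lam) (isUnitary_toHeckeCharacter L lam) ((isOscillatorChar_toHeckeCharacter_iff lam).mpr hlam) (TW (Fp L) b) (isSymm_TW (Fp L) b) (isUnit_det_TW (Fp L) b) (JW (Fp L) L b) (JW_eq (Fp L) L b)) a' χ)]
    (hiso : Nonempty ((show Representation ℂ (localPi L (IsCMField.complexConj L) 2 (Matrix.diagonal dV) v) _ from (TwistedCoinv.rep (localCharOfCenter (Fp L) L (IsCMField.complexConj L) (JW (Fp L) L a) (JW_apply_ne_zero (Fp L) L a) χ.1 v) (((congrW L e₁ dV hdV (lineW L (TW (Fp L) a)) (complexConj_lineW L (TW (Fp L) a)) (realDiagonal_lineW L (TW (Fp L) a)) (diagonal_lineW L (TW (Fp L) a) (JW_eq (Fp L) L a)) (undoubledSplittings L e₁ dV hdV hdV0 (lineW L (TW (Fp L) a)) (complexConj_lineW L (TW (Fp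 L) a)) (lineW_ne_zero L (TW (Fp L) a) (isUnit_det_TW (Fp L) a)) (toHeckeCharacter L lam) (borelPlaceMeasure L) (cmFinLocalFamily L e₁ dV hdV hdV0 (lineW L (TW (Fp L) a)) (complexConj_lineW L (TW (Fp L) a)) (lineW_ne_zero L (TW (Fp L) a) (isUnit_det_TW (Fp L) a)) (toHeckeCharacter L lam) ((isOscillatorChar_toHeckeCharacter_iff lam).mpr hlam) (borelPlaceMeasure L))) (isSymm_TW (Fp L) a) (JW_eq (Fp L) L a))).omegaLoc v) (commute_omegaLoc_localCenter (Fp L) L (IsCMField.complexConj L) 2 e₁ (Matrix.diagonal dV) (JW (Fp L) L a) (complexConj_imagUnit L) (imagUnit_ne_zero L) (imagUnit_mul_self L) (realDiagonal_isSymm L dV hdV) (isSymm_TW (Fp L) a) (realDiagonal_map L dV hdV).symm (JW_eq (Fp L) L a) (JW_apply_ne_zero (Fp L) L a) (congrW L e₁ dV hdV (lineW L (TW (Fp L) a)) (complexConj_lineW L (TW (Fp L) a)) (realDiagonal_lineW L (TW (Fp L) a)) (diagonal_lineW L (TW (Fp L) a) (JW_eq (Fp L) L a)) (undoubledSplittings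 L e₁ dV hdV hdV0 (lineW L (TW (Fp L) a)) (complexConj_lineW L (TW (Fp L) a)) (lineW_ne_zero L (TW (Fp L) a) (isUnit_det_TW (Fp L) a)) (toHeckeCharacter L lam) (borelPlaceMeasure L) (cmFinLocalFamily L e₁ dV hdV hdV0 (lineW L (TW (Fp L) a)) (complexConj_lineW L (TW (Fp L) a)) (lineW_ne_zero L (TW (Fp L) a) (isUnit_det_TW (Fp L) a)) (toHeckeCharacter L lam) ((isOscillatorChar_toHeckeCharacter_iff lam).mpr hlam) (borelPlaceMeasure L))) (isSymm_TW (Fp L) a) (JW_eq (Fp L) L a)) v)).comp (localLineInl L (IsCMField.complexConj L) 2 e₁ (Matrix.diagonal dV) (JW (Fp L) L a) v)).Equiv (show Representation ℂ (localPi L (IsCMField.complexConj L) 2 (Matrix.diagonal dV) v) _ from (TwistedCoinv.rep (localCharOfCenter (Fp L) L (IsCMField.complexConj L) (JW (Fp L) L a') (JW_apply_ne_zero (Fp L) L a') χ.1 v) (((congrW L e₁ dV hdV (lineW L (TW (Fp L) a')) (complexConj_lineW L (TW (Fp L) a')) (realDiagonal_lineW L (TW (Fp L) a')) (diagonal_lineW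 L (TW (Fp L) a') (JW_eq (Fp L) L a')) (undoubledSplittings L e₁ dV hdV hdV0 (lineW L (TW (Fp L) a')) (complexConj_lineW L (TW (Fp L) a')) (lineW_ne_zero L (TW (Fp L) a') (isUnit_det_TW (Fp L) a')) (toHeckeCharacter L lam) (borelPlaceMeasure L) (cmFinLocalFamily L e₁ dV hdV hdV0 (lineW L (TW (Fp L) a')) (complexConj_lineW L (TW (Fp L) a')) (lineW_ne_zero L (TW (Fp L) a') (isUnit_det_TW (Fp L) a')) (toHeckeCharacter L lam) ((isOscillatorChar_toHeckeCharacter_iff lam).mpr hlam) (borelPlaceMeasure L))) (isSymm_TW (Fp L) a') (JW_eq (Fp L) L a'))).omegaLoc v) (commute_omegaLoc_localCenter (Fp L) L (IsCMField.complexConj L) 2 e₁ (Matrix.diagonal dV) (JW (Fp L) L a') (complexConj_imagUnit L) (imagUnit_ne_zero L) (imagUnit_mul_self L) (realDiagonal_isSymm L dV hdV) (isSymm_TW (Fp L) a') (realDiagonal_map L dV hdV).symm (JW_eq (Fp L) L a') (JW_apply_ne_zero (Fp L) L a') (congrW L e₁ dV hdV (lineW L (TW (Fp L) a')) (complexConj_lineW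 L (TW (Fp L) a')) (realDiagonal_lineW L (TW (Fp L) a')) (diagonal_lineW L (TW (Fp L) a') (JW_eq (Fp L) L a')) (undoubledSplittings L e₁ dV hdV hdV0 (lineW L (TW (Fp L) a')) (complexConj_lineW L (TW (Fp L) a')) (lineW_ne_zero L (TW (Fp L) a') (isUnit_det_TW (Fp L) a')) (toHeckeCharacter L lam) (borelPlaceMeasure L) (cmFinLocalFamily L e₁ dV hdV hdV0 (lineW L (TW (Fp L) a')) (complexConj_lineW L (TW (Fp L) a')) (lineW_ne_zero L (TW (Fp L) a') (isUnit_det_TW (Fp L) a')) (toHeckeCharacter L lam) ((isOscillatorChar_toHeckeCharacter_iff lam).mpr hlam) (borelPlaceMeasure L))) (isSymm_TW (Fp L) a') (JW_eq (Fp L) L a')) v)).comp (localLineInl L (IsCMField.complexConj L) 2 e₁ (Matrix.diagonal dV) (JW (Fp L) L a') v)))) :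
    locF (Fp L) (imagUnitSq L) a v = locF (Fp L) (imagUnitSq L) a' v := by
  have hn' : 2 ≤ n' := two_le_of_finTwo_equiv e₁
  haveI : NeZero n' := ⟨by omega⟩
  -- the local central `χ_v`-quotients at `(λ, a)` and `(λ, a′)` are non-zero (⊗′ structure, ★)
  have hi_a : Nontrivial (TwistedCoinv.Coinv (show Representation ℂ (UnitaryGroup.localPi L (IsCMField.complexConj L) 1 (JW (Fp L) L a) v) (SchwartzBruhat (Fin n' → v.adicCompletion (Fp L))) from (((congrW L e₁ dV hdV (lineW L (TW (Fp L) a)) (complexConj_lineW L (TW (Fp L) a)) (realDiagonal_lineW L (TW (Fp L) a)) (diagonal_lineW L (TW (Fp L) a) (JW_eq (Fp L) L a)) (undoubledSplittings L e₁ dV hdV hdV0 (lineW L (TW (Fp L) a)) (complexConj_lineW L (TW (Fp L) a)) (lineW_ne_zero L (TW (Fp L) a) (isUnit_det_TW (Fp L) a)) (toHeckeCharacter L lam) (borelPlaceMeasure L) (cmFinLocalFamily L e₁ dV hdV hdV0 (lineW L (TW (Fp L) a)) (complexConj_lineW L (TW (Fp L) a)) (lineW_ne_zero L (TW (Fp L)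 a) (isUnit_det_TW (Fp L) a)) (toHeckeCharacter L lam) ((isOscillatorChar_toHeckeCharacter_iff lam).mpr hlam) (borelPlaceMeasure L))) (isSymm_TW (Fp L) a) (JW_eq (Fp L) L a))).omegaLoc v).comp (localCenter L (IsCMField.complexConj L) n' (Matrix.reindex e₁ e₁ (Matrix.diagonal dV ⊗ₖ JW (Fp L) L a)) (JW (Fp L) L a) (JW_apply_ne_zero (Fp L) L a) v)) (localCharOfCenter (Fp L) L (IsCMField.complexConj L) (JW (Fp L) L a) (JW_apply_ne_zero (Fp L) L a) χ.1 v)) :=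
    nontrivial_localCoinv_of_nontrivial_omegaAtLine L e₁ dV hdV hdV0 lam hlam a χ v
  have hi_a' : Nontrivial (TwistedCoinv.Coinv (show Representation ℂ (UnitaryGroup.localPi L (IsCMField.complexConj L) 1 (JW (Fp L) L a') v) (SchwartzBruhat (Fin n' → v.adicCompletion (Fp L))) from (((congrW L e₁ dV hdV (lineW L (TW (Fp L) a')) (complexConj_lineW L (TW (Fp L) a')) (realDiagonal_lineW L (TW (Fp L) a')) (diagonal_lineW L (TW (Fp L) a') (JW_eq (Fp L) L a')) (undoubledSplittings L e₁ dV hdV hdV0 (lineW L (TW (Fp L) a')) (complexConj_lineW L (TW (Fp L) a')) (lineW_ne_zero L (TW (Fp L) a') (isUnit_det_TW (Fp L) a')) (toHeckeCharacter L lam) (borelPlaceMeasure L) (cmFinLocalFamily L e₁ dV hdV hdV0 (lineW L (TW (Fp L) a')) (complexConj_lineW L (TW (Fp L) a')) (lineW_ne_zero L (TW (Fp L) a') (isUnit_det_TW (Fp L) a')) (toHeckeCharacter L lam) ((isOscillatorChar_toHeckeCharacter_iff lam).mpr hlam) (borelPlaceMeasure L))) (isSymm_TW (Fp L) a') (JW_eq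 (Fp L) L a'))).omegaLoc v).comp (localCenter L (IsCMField.complexConj L) n' (Matrix.reindex e₁ e₁ (Matrix.diagonal dV ⊗ₖ JW (Fp L) L a')) (JW (Fp L) L a') (JW_apply_ne_zero (Fp L) L a') v)) (localCharOfCenter (Fp L) L (IsCMField.complexConj L) (JW (Fp L) L a') (JW_apply_ne_zero (Fp L) L a') χ.1 v)) :=
    nontrivial_localCoinv_of_nontrivial_omegaAtLine L e₁ dV hdV hdV0 lam hlam a' χ v
  -- the companion local isomorphism `Θ_v(λ′, b, χ) ≅ Θ_v(λ, a, χ)` from the PROVED «if» half of Lem. D.1 (4)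
  have hcomp := areIsomorphicRep_localFactor_companion_of_lemD1_4IfAsPrintedI L e₁ dV hdV hdV0 lam hlam a χ b lam' hlam' v hcc hH
    hJh hJdet hflipv hi_a (lemD1_4IfAsPrintedNonsplitCM₂_holds L dV hdV hdV0 e₁ lam hlam a χ b lam' hlam' hcc hH v hns)
  -- … composed with the given equivalence: `Θ_v(λ′, b, χ) ≅ Θ_v(λ, a′, χ)`
  have hiso' : AreIsomorphicRep (show Representation ℂ (localPi L (IsCMField.complexConj L) 2 (Matrix.diagonal dV) v) _ from (TwistedCoinv.rep (localCharOfCenter (Fp L) L (IsCMField.complexConj L) (JW (Fp L) L b) (JW_apply_ne_zero (Fp L) L b) χ.1 v) (((congrW L e₁ dV hdV (lineW L (TW (Fp L) b)) (complexConj_lineW L (TW (Fp L) b)) (realDiagonal_lineW L (TW (Fp L) b)) (diagonal_lineW L (TW (Fp L) b) (JW_eq (Fp L) L b)) (undoubledSplittings L e₁ dV hdV hdV0 (lineW L (TW (Fp L) b)) (complexConj_lineW L (TW (Fp L) b)) (lineW_ne_zero L (TW (Fp L) b) (isUnit_det_TW (Fp L) b)) (toHeckeCharacter L lam') (borelPlaceMeasure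 L) (cmFinLocalFamily L e₁ dV hdV hdV0 (lineW L (TW (Fp L) b)) (complexConj_lineW L (TW (Fp L) b)) (lineW_ne_zero L (TW (Fp L) b) (isUnit_det_TW (Fp L) b)) (toHeckeCharacter L lam') ((isOscillatorChar_toHeckeCharacter_iff lam').mpr hlam') (borelPlaceMeasure L))) (isSymm_TW (Fp L) b) (JW_eq (Fp L) L b))).omegaLoc v) (commute_omegaLoc_localCenter (Fp L) L (IsCMField.complexConj L) 2 e₁ (Matrix.diagonal dV) (JW (Fp L) L b) (complexConj_imagUnit L) (imagUnit_ne_zero L) (imagUnit_mul_self L) (realDiagonal_isSymm L dV hdV) (isSymm_TW (Fp L) b) (realDiagonal_map L dV hdV).symm (JW_eq (Fp L) L b) (JW_apply_ne_zero (Fp L) L b) (congrW L e₁ dV hdV (lineW L (TW (Fp L) b)) (complexConj_lineW L (TW (Fp L) b)) (realDiagonal_lineW L (TW (Fp L) b)) (diagonal_lineW L (TW (Fp L) b) (JW_eq (Fp L) L b)) (undoubledSplittings L e₁ dV hdV hdV0 (lineW L (TW (Fp L) b)) (complexConj_lineW L (TW (Fp L) b)) (lineW_ne_zero L (TW (Fp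 L) b) (isUnit_det_TW (Fp L) b)) (toHeckeCharacter L lam') (borelPlaceMeasure L) (cmFinLocalFamily L e₁ dV hdV hdV0 (lineW L (TW (Fp L) b)) (complexConj_lineW L (TW (Fp L) b)) (lineW_ne_zero L (TW (Fp L) b) (isUnit_det_TW (Fp L) b)) (toHeckeCharacter L lam') ((isOscillatorChar_toHeckeCharacter_iff lam').mpr hlam') (borelPlaceMeasure L))) (isSymm_TW (Fp L) b) (JW_eq (Fp L) L b)) v)).comp (localLineInl L (IsCMField.complexConj L) 2 e₁ (Matrix.diagonal dV) (JW (Fp L) L b) v)) (show Representation ℂ (localPi L (IsCMField.complexConj L) 2 (Matrix.diagonal dV) v) _ from (TwistedCoinv.rep (localCharOfCenter (Fp L) L (IsCMField.complexConj L) (JW (Fp L) L a') (JW_apply_ne_zero (Fp L) L a') χ.1 v) (((congrW L e₁ dV hdV (lineW L (TW (Fp L) a')) (complexConj_lineW L (TW (Fp L) a')) (realDiagonal_lineW L (TW (Fp L) a')) (diagonal_lineW L (TW (Fp L) a') (JW_eq (Fp L) L a')) (undoubledSplittings L e₁ dV hdV hdV0 (lineW L (TW (Fp L) a')) (complexConj_lineW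 L (TW (Fp L) a')) (lineW_ne_zero L (TW (Fp L) a') (isUnit_det_TW (Fp L) a')) (toHeckeCharacter L lam) (borelPlaceMeasure L) (cmFinLocalFamily L e₁ dV hdV hdV0 (lineW L (TW (Fp L) a')) (complexConj_lineW L (TW (Fp L) a')) (lineW_ne_zero L (TW (Fp L) a') (isUnit_det_TW (Fp L) a')) (toHeckeCharacter L lam) ((isOscillatorChar_toHeckeCharacter_iff lam).mpr hlam) (borelPlaceMeasure L))) (isSymm_TW (Fp L) a') (JW_eq (Fp L) L a'))).omegaLoc v) (commute_omegaLoc_localCenter (Fp L) L (IsCMField.complexConj L) 2 e₁ (Matrix.diagonal dV) (JW (Fp L) L a') (complexConj_imagUnit L) (imagUnit_ne_zero L) (imagUnit_mul_self L) (realDiagonal_isSymm L dV hdV) (isSymm_TW (Fp L) a') (realDiagonal_map L dV hdV).symm (JW_eq (Fp L) L a') (JW_apply_ne_zero (Fp L) L a') (congrW L e₁ dV hdV (lineW L (TW (Fp L) a')) (complexConj_lineW L (TW (Fp L) a')) (realDiagonal_lineW L (TW (Fp L) a')) (diagonal_lineW L (TW (Fp L) a') (JW_eq (Fp L) L a'))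 (undoubledSplittings L e₁ dV hdV hdV0 (lineW L (TW (Fp L) a')) (complexConj_lineW L (TW (Fp L) a')) (lineW_ne_zero L (TW (Fp L) a') (isUnit_det_TW (Fp L) a')) (toHeckeCharacter L lam) (borelPlaceMeasure L) (cmFinLocalFamily L e₁ dV hdV hdV0 (lineW L (TW (Fp L) a')) (complexConj_lineW L (TW (Fp L) a')) (lineW_ne_zero L (TW (Fp L) a') (isUnit_det_TW (Fp L) a')) (toHeckeCharacter L lam) ((isOscillatorChar_toHeckeCharacter_iff lam).mpr hlam) (borelPlaceMeasure L))) (isSymm_TW (Fp L) a') (JW_eq (Fp L) L a')) v)).comp (localLineInl L (IsCMField.complexConj L) 2 e₁ (Matrix.diagonal dV) (JW (Fp L) L a') v)) :=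
    hiso.elim fun E => hcomp.trans (areIsomorphicRep_of_equiv E)
  -- the FULL letter read on the family `0 := (λ, a′, χ)`, `1 := (λ′, b, χ)` at `v` (★ (r1))
  have key := lemD1_4_localFactors_of_lemD1_4AsPrintedI₂ (Fp L) L (IsCMField.complexConj L) 2 e₁ (Matrix.diagonal dV) (complexConj_imagUnit L) (imagUnit_ne_zero L) (imagUnit_mul_self L) (realDiagonal_isSymm L dV hdV) (isUnit_det_realDiagonal L dV hdV hdV0) (realDiagonal_map L dV hdV).symm (two_le_of_finTwo_equiv e₁) ![a', b] (fun _ => χ)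
    (Fin.cons (α := fun i : Fin 2 => LocalSplitting.FinLocalSplittings (Fp L) L (IsCMField.complexConj L) n' (complexConj_imagUnit L)
      (imagUnit_ne_zero L) (imagUnit_mul_self L) (gram (Fp L) e₁ (realDiagonal L dV hdV) (TW (Fp L) (![a', b] i)))
      (isSymm_gram (Fp L) e₁ (realDiagonal_isSymm L dV hdV) (isSymm_TW (Fp L) (![a', b] i)))
      (reindex_kronecker_eq_gram_map (Fp L) L e₁ (realDiagonal_map L dV hdV).symm (JW_eq (Fp L) L (![a', b] i))))
      (congrW L e₁ dV hdV (lineW L (TW (Fp L) a')) (complexConj_lineW L (TW (Fp L) a')) (realDiagonal_lineW L (TW (Fp L) a')) (diagonal_lineW L (TW (Fp L) a') (JW_eq (Fp L) L a')) (undoubledSplittings L e₁ dV hdV hdV0 (lineW L (TW (Fp L) a')) (complexConj_lineW L (TW (Fp L) a')) (lineW_ne_zero L (TW (Fp L) a') (isUnit_det_TW (Fp L) a')) (toHeckeCharacter L lam) (borelPlaceMeasure L) (cmFinLocalFamily L e₁ dV hdV hdV0 (lineW L (TW (Fp L) a')) (complexConj_lineW L (TW (Fp L) a')) (lineW_ne_zero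 L (TW (Fp L) a') (isUnit_det_TW (Fp L) a')) (toHeckeCharacter L lam) ((isOscillatorChar_toHeckeCharacter_iff lam).mpr hlam) (borelPlaceMeasure L))) (isSymm_TW (Fp L) a') (JW_eq (Fp L) L a')) (Fin.cons (congrW L e₁ dV hdV (lineW L (TW (Fp L) b)) (complexConj_lineW L (TW (Fp L) b)) (realDiagonal_lineW L (TW (Fp L) b)) (diagonal_lineW L (TW (Fp L) b) (JW_eq (Fp L) L b)) (undoubledSplittings L e₁ dV hdV hdV0 (lineW L (TW (Fp L) b)) (complexConj_lineW L (TW (Fp L) b)) (lineW_ne_zero L (TW (Fp L) b) (isUnit_det_TW (Fp L) b)) (toHeckeCharacter L lam') (borelPlaceMeasure L) (cmFinLocalFamily L e₁ dV hdV hdV0 (lineW L (TW (Fp L) b)) (complexConj_lineW L (TW (Fp L) b)) (lineW_ne_zero L (TW (Fp L) b) (isUnit_det_TW (Fp L) b)) (toHeckeCharacter L lam') ((isOscillatorChar_toHeckeCharacter_iff lam').mpr hlam') (borelPlaceMeasure L))) (isSymm_TW (Fp L) b) (JW_eq (Fp L) L b)) finZeroElim))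
    ![localMu L (toHeckeCharacter L lam), localMu L (toHeckeCharacter L lam')] (norm_localMu_pair L lam lam')
    (continuous_localMu_pair L lam lam') (localMu_pair_toLocalRing_eq_one_iff L lam hlam lam' hlam') v
    (h4 L dV hdV hdV0 e₁ lam hlam a' χ b lam' hlam' hcc hH v hns) rfl 0 1 hi_a'
  have hdisj := key.1 hiso'
  by_cases hV : LemD1.IsIsotropic (LemD1OfPlace.standingData L v (IsCMField.complexConj L) 2 (Matrix.diagonal dV)
      (complexConj_imagUnit L) (imagUnit_ne_zero L) le_rfl hJh hJdet)
  · -- ISOTROPIC: both alternatives put `a′` in the class of `b`, and `b ~ a`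
    have hsame := hdisj.elim (fun h => h.2.1) (fun h => h.2.2.1 hV)
    have hab : locF (Fp L) (imagUnitSq L) a' v = locF (Fp L) (imagUnitSq L) b v :=
      locF_apply_eq_of_sameClass_epsLine (Fp L) L (IsCMField.complexConj L) 2 (Matrix.diagonal dV) (complexConj_imagUnit L)
        (imagUnit_ne_zero L) (imagUnit_mul_self L) le_rfl hJh hJdet v a' b hsame
    exact (hab.trans (hflipv.2 hV)).symm
  · -- ANISOTROPIC
    -- the real diagonal `t` with `diag dV = diag t ⊗ 1`; `d = δ²` is a non-square at `v`
    let t : Fin 2 → Fp L := fun i => ⟨dV i, (IsCMField.complexConj_eq_self_iff (K := L) (dV i)).1 (hdV i)⟩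
    have hJ : Matrix.diagonal dV = (Matrix.diagonal t).map (algebraMap (Fp L) L) := by
      rw [Matrix.diagonal_map (map_zero _)]; rfl
    have ht : ∀ i, t i ≠ 0 := fun i h => hdV0 i (congrArg Subtype.val h)
    have hns_sq : ¬ IsSquare (algebraMap (Fp L) (v.adicCompletion (Fp L)) (imagUnitSq L)) :=
      not_isSquare_of_not_isIsotropic L v (IsCMField.complexConj L) (complexConj_imagUnit L) (imagUnit_ne_zero L) t hJ hJh hJdet
        (imagUnit_mul_self L) ht hV
    refine hdisj.elim (fun hA => ?_) (fun hB => ?_)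
    · -- (A) `λ′_v = λ_v`: then `χ̌_v = λ_v²`, and letter (1) makes `Θ_v(λ, a′, χ)` ZERO — contradiction
      exfalso
      have heq : ∀ x, localMu L (toHeckeCharacter L lam') v x = localMu L (toHeckeCharacter L lam) v x := fun x =>
        congrArg (fun m => (m.1 : (LocalRing L v)ˣ →* ℂˣ) x) hA.1
      have hH' : toHeckeCharacter L lam' =
          HeckeCharacter.galConj (IsCMField.complexConj L) (toHeckeCharacter L lam) * HeckeCharacter.checkOfChi hcc χ := by
        rw [hH, toHeckeCharacter_galConj]
      -- `χ̌_v(x) = λ_v(x)²`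
      have hsq : ∀ x : (LocalRing L v)ˣ,
          (LemD1OfPlace.standingData L v (IsCMField.complexConj L) 2 (Matrix.diagonal dV) (complexConj_imagUnit L) (imagUnit_ne_zero L)
              le_rfl hJh hJdet).check
            ((localCharOfCenter (Fp L) L (IsCMField.complexConj L) (JW (Fp L) L a') (JW_apply_ne_zero (Fp L) L a')
                (χ : UnitaryGroup.finAdelicOne (Fp L) L (IsCMField.complexConj L) →* ℂˣ) v).comp
              (LemD1OfPlace.theta L v (IsCMField.complexConj L) 2 (Matrix.diagonal dV) (complexConj_imagUnit L) (imagUnit_ne_zero L)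
                le_rfl hJh hJdet (JW (Fp L) L a'))) x =
            localMu L (toHeckeCharacter L lam) v x ^ 2 := fun x => by
        have e1 := heq x
        rw [hH', CheckOfChi.localMu_galConj_mul_checkOfChi_apply L hcc χ (complexConj_imagUnit L) (imagUnit_ne_zero L) le_rfl hJh hJdet
          (JW_apply_ne_zero (Fp L) L a') (toHeckeCharacter L lam) x] at e1
        have e2 := localMu_mul_localMu_conj_eq_one L lam hlam v x
        rw [eq_inv_of_mul_eq_one_right e2, inv_mul_eq_iff_eq_mul] at e1
        rw [e1, sq]
      -- letter (1) at the datum `(λ, a′, χ, v)`: zero iff (field ∧ anisotropic ∧ `χ̌ = μ²`)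
      have hD1 := (h1 L dV hdV hdV0 e₁ χ a' lam hlam v).2
      have hsub := hD1.2 ⟨isField_localRing_of_not_isSquare L v (IsCMField.complexConj L) (complexConj_imagUnit L) (imagUnit_ne_zero L)
          (imagUnit_mul_self L) hns_sq,
        ⟨(LemD1Data.isAnisotropic_iff_not_isIsotropic _).2 hV, rfl⟩, hsq⟩
      have hnt := (nontrivial_localType₂_iff_quot (Fp L) L (IsCMField.complexConj L) 2 e₁ (Matrix.diagonal dV) (complexConj_imagUnit L) (imagUnit_ne_zero L) (imagUnit_mul_self L) (realDiagonal_isSymm L dV hdV) (isUnit_det_realDiagonal L dV hdV hdV0) (realDiagonal_map L dV hdV).symm (two_le_of_finTwo_equiv e₁) ![a', b] (fun _ => χ)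
        (Fin.cons (α := fun i : Fin 2 => LocalSplitting.FinLocalSplittings (Fp L) L (IsCMField.complexConj L) n' (complexConj_imagUnit L)
          (imagUnit_ne_zero L) (imagUnit_mul_self L) (gram (Fp L) e₁ (realDiagonal L dV hdV) (TW (Fp L) (![a', b] i)))
          (isSymm_gram (Fp L) e₁ (realDiagonal_isSymm L dV hdV) (isSymm_TW (Fp L) (![a', b] i)))
          (reindex_kronecker_eq_gram_map (Fp L) L e₁ (realDiagonal_map L dV hdV).symm (JW_eq (Fp L) L (![a', b] i))))
          (congrW L e₁ dV hdV (lineW L (TW (Fp L) a')) (complexConj_lineW L (TW (Fp L) a')) (realDiagonal_lineW L (TW (Fp L) a')) (diagonal_lineW L (TW (Fp L) a') (JW_eq (Fp L) L a')) (undoubledSplittings L e₁ dV hdV hdV0 (lineW L (TW (Fp L) a')) (complexConj_lineW L (TW (Fp L) a')) (lineW_ne_zero L (TW (Fp L) a') (isUnit_det_TW (Fp L) a')) (toHeckeCharacter L lam) (borelPlaceMeasure L) (cmFinLocalFamily L e₁ dV hdV hdV0 (lineW L (TW (Fp L) a')) (complexConj_lineW L (TW (Fp L) a')) (lineW_ne_zero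 L (TW (Fp L) a') (isUnit_det_TW (Fp L) a')) (toHeckeCharacter L lam) ((isOscillatorChar_toHeckeCharacter_iff lam).mpr hlam) (borelPlaceMeasure L))) (isSymm_TW (Fp L) a') (JW_eq (Fp L) L a')) (Fin.cons (congrW L e₁ dV hdV (lineW L (TW (Fp L) b)) (complexConj_lineW L (TW (Fp L) b)) (realDiagonal_lineW L (TW (Fp L) b)) (diagonal_lineW L (TW (Fp L) b) (JW_eq (Fp L) L b)) (undoubledSplittings L e₁ dV hdV hdV0 (lineW L (TW (Fp L) b)) (complexConj_lineW L (TW (Fp L) b)) (lineW_ne_zero L (TW (Fp L) b) (isUnit_det_TW (Fp L) b)) (toHeckeCharacter L lam') (borelPlaceMeasure L) (cmFinLocalFamily L e₁ dV hdV hdV0 (lineW L (TW (Fp L) b)) (complexConj_lineW L (TW (Fp L) b)) (lineW_ne_zero L (TW (Fp L) b) (isUnit_det_TW (Fp L) b)) (toHeckeCharacter L lam') ((isOscillatorChar_toHeckeCharacter_iff lam').mpr hlam') (borelPlaceMeasure L))) (isSymm_TW (Fp L) b) (JW_eq (Fp L) L b)) finZeroElim))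
        ![localMu L (toHeckeCharacter L lam), localMu L (toHeckeCharacter L lam')] (norm_localMu_pair L lam lam')
        (continuous_localMu_pair L lam lam') (localMu_pair_toLocalRing_eq_one_iff L lam hlam lam' hlam') v 0).2 hi_a'
      exact (not_nontrivial_iff_subsingleton.mpr hsub) hnt
    · -- (B) the companion alternative: `a′ ≁ b` and `b ≁ a` at the anisotropic `v`, so `a′ ~ a` (two classes)
      have hne1 : locF (Fp L) (imagUnitSq L) a' v ≠ locF (Fp L) (imagUnitSq L) b v :=
        (not_sameClass_epsLine_iff_locF_apply_ne (Fp L) L (IsCMField.complexConj L) 2 (Matrix.diagonal dV) (complexConj_imagUnit L)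
          (imagUnit_ne_zero L) (imagUnit_mul_self L) le_rfl hJh hJdet v a' b).1 (hB.2.2.2 hV)
      have hne2 : locF (Fp L) (imagUnitSq L) b v ≠ locF (Fp L) (imagUnitSq L) a v := fun h => hV (hflipv.1 h)
      by_contra hne3
      have h1' := (ne_iff_flip_of_not_isSquare v (imagUnitSq L) hns_sq _ _).1 hne1
      have h2' := (ne_iff_flip_of_not_isSquare v (imagUnitSq L) hns_sq _ _).1 hne2
      have h3' := (ne_iff_flip_of_not_isSquare v (imagUnitSq L) hns_sq _ _).1 hne3
      tauto

end Place

end Summit.HodgeConjecture.HodgeConjecture.Cruxes.HLiu418.F0LD2SameLabelLineClassAtPlace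

end
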